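import Summits.CriticalPhenomena.PercolationContinuityZ3.Theorems.PercNearOneGluingNoHeavyLowerTailSunflowerMultiPetalSlackPatterns
import Summits.CriticalPhenomena.PercolationContinuityZ3.Theorems.PercNearOneGluingNoHeavyLowerTailSunflowerMultiPetalSlackMonotone
import HarnessLib
import HarnessLib.Audit

/-!
# `NoHeavyLowerTail` (crux stmt-CriticalPhenomena-4575), abstract sunflower cubic, `k` petals: RESTRICTION TO A SUB-CUBE as an `MSunflower`
# on the subtype `↥W`, with transport of `lab`, of the top-cube slack (`slackTop ↦ pslack W ∅`) and of the partition functional (`ZK ↦ ZKW W`)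

Support file (seat `prim-l12-p2` gen 32; `--supports stmt-CriticalPhenomena-4575`; companion of `…SunflowerMultiPetalSlackExpansion` (p364652:
`slackTop`), `…SunflowerMultiPetalSlackMonotone` (p363882: `pslack`) and `…SunflowerMultiPetalRestriction` (p340634: `ZKW`)).
Everything here is PROVED (no `sorry`, no named fact, no conjecture).  Memo: run/shared/lean/prim/prim-l12/prim-l12-p2/FINDING-g32.md §1.

PURPOSE.  Many theorems of the programme are stated for the FULL cube of a finite type (`slackTop`, `ZK`, Theorem T, the composition theorems),
while the slot form of ★ₖ (`ZK = 3·SwK [decided] − NtriK`) and every restriction induction need them on SUB-CUBES `2^W`.  This file supplies the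
transport once and for all:
* `MSunflower.liftW W : Finset ↥W → Finset α` (with `liftEmb`, `powerset_liftW`, `powerset_eq_map_liftEmb`: the subsets of `W` are exactly the lifts);
* `MSunflower.restrict F W : MSunflower k ↥W` — the monotone map `2^W → M_k` induced by `F`;  `lab_restrict : (F.restrict W).lab S = F.lab (liftW W S)`;
* `slackTop_restrict : (F.restrict W).slackTop = F.pslack W ∅`;  `nested_univ_liftW`;  `ZK_restrict : (F.restrict W).ZK = F.ZKW W`;
* example of use: `ZKW_nonneg_of_partitionLemmaK` (★ₖ gives every sub-cube functional `≥ 0`).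
The W-relative Theorem T (`2 ≤ pslack W ∅` when `2^W` sees three petals) is the companion file `…SunflowerMultiPetalRestrictT`.
-/

namespace Summit.CriticalPhenomena.PercolationContinuityZ3.Theorems.SunflowerPartition

open Finset

variable {α : Type*} [DecidableEq α]

namespace MSunflower

variable {k : ℕ} (F : MSunflower k α) (W : Finset α)

/-! ## §1 Lifting subsets of the subtype `↥W` to subsets of `W` -/

/-- Lift a finite set of elements of the subtype `↥W` to a subset of `W`. [this work] -/
def liftW (W : Finset α) (S : Finset {x // x ∈ W}) : Finset α := S.map (Function.Embedding.subtype (· ∈ W))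

omit [DecidableEq α] in
/-- Membership in a lifted set. [this work] -/
theorem mem_liftW {S : Finset {x // x ∈ W}} {x : α} : x ∈ liftW W S ↔ ∃ h : x ∈ W, (⟨x, h⟩ : {x // x ∈ W}) ∈ S := by
  unfold liftW
  rw [mem_map]
  constructor
  · rintro ⟨y, hy, rfl⟩
    exact ⟨y.2, by simpa using hy⟩
  · rintro ⟨h, hS⟩
    exact ⟨⟨x, h⟩, hS, rfl⟩

omit [DecidableEq α] in
/-- A lifted set is a subset of `W`. [this work] -/
theorem liftW_subset (S : Finset {x // x ∈ W}) : liftW W S ⊆ W := by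
  intro x hx
  obtain ⟨h, _⟩ := (mem_liftW W).1 hx
  exact h

omit [DecidableEq α] in
/-- `liftW` is monotone (and reflects inclusion). [this work] -/
theorem liftW_subset_liftW {S T : Finset {x // x ∈ W}} : liftW W S ⊆ liftW W T ↔ S ⊆ T := by
  unfold liftW; exact map_subset_map

omit [DecidableEq α] in
/-- `liftW` is injective. [this work] -/
theorem liftW_injective : Function.Injective (liftW W) := by
  intro S T h
  exact (map_injective (Function.Embedding.subtype (· ∈ W))) h

omit [DecidableEq α] in
/-- Lifting the whole subtype gives `W`. [this work] -/
theorem liftW_univ : liftW W (univ : Finset {x // x ∈ W}) = W := by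
  ext x
  rw [mem_liftW]
  constructor
  · rintro ⟨h, _⟩; exact h
  · intro h; exact ⟨h, mem_univ _⟩

/-- `liftW` commutes with set difference. [this work] -/
theorem liftW_sdiff (S T : Finset {x // x ∈ W}) : liftW W (S \ T) = liftW W S \ liftW W T := by
  ext x
  rw [mem_sdiff, mem_liftW, mem_liftW, mem_liftW]
  constructor
  · rintro ⟨h, hST⟩
    rw [mem_sdiff] at hST
    exact ⟨⟨h, hST.1⟩, fun ⟨h', hT⟩ => hST.2 hT⟩
  · rintro ⟨⟨h, hS⟩, hT⟩
    exact ⟨h, mem_sdiff.2 ⟨hS, fun hT' => hT ⟨h, hT'⟩⟩⟩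

/-- `liftW` of a complement (in the subtype) is the complement inside `W`. [this work] -/
theorem liftW_compl (S : Finset {x // x ∈ W}) : liftW W Sᶜ = W \ liftW W S := by
  rw [compl_eq_univ_sdiff, liftW_sdiff, liftW_univ]

/-- `liftW` commutes with union. [this work] -/
theorem liftW_union (S T : Finset {x // x ∈ W}) : liftW W (S ∪ T) = liftW W S ∪ liftW W T := by
  unfold liftW; exact map_union _ _

/-- A subset of `W` is the lift of its subtype. [this work] -/
theorem liftW_subtype {T : Finset α} (hT : T ⊆ W) : liftW W (T.subtype (· ∈ W)) = T :=
  subtype_map_of_mem fun _ hx => hT hx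

/-- The lifting embedding `Finset ↥W ↪ Finset α`. [this work] -/
def liftEmb (W : Finset α) : Finset {x // x ∈ W} ↪ Finset α := ⟨liftW W, liftW_injective W⟩

omit [DecidableEq α] in
/-- `liftEmb` is `liftW`. [this work] -/
theorem liftEmb_apply (S : Finset {x // x ∈ W}) : liftEmb W S = liftW W S := rfl

/-- The subsets of a lifted set are exactly the lifts of the subsets. [this work] -/
theorem powerset_liftW (X : Finset {x // x ∈ W}) : (liftW W X).powerset = X.powerset.map (liftEmb W) := by
  ext T
  rw [mem_powerset, mem_map]
  constructor
  · intro hT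
    have hTW : T ⊆ W := hT.trans (liftW_subset W X)
    refine ⟨T.subtype (· ∈ W), mem_powerset.2 ?_, ?_⟩
    · rw [← liftW_subset_liftW W, liftW_subtype W hTW]; exact hT
    · rw [liftEmb_apply, liftW_subtype W hTW]
  · rintro ⟨S, hS, rfl⟩
    rw [liftEmb_apply, liftW_subset_liftW]
    exact mem_powerset.1 hS

/-- In particular the subsets of `W` are exactly the lifts of the finite sets of the subtype. [this work] -/
theorem powerset_eq_map_liftEmb : W.powerset = (univ : Finset (Finset {x // x ∈ W})).map (liftEmb W) := by
  have h := powerset_liftW W (univ : Finset {x // x ∈ W})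
  rwa [liftW_univ, powerset_univ] at h

/-! ## §2 The restriction of an `MSunflower` to the sub-cube `2^W` -/

/-- **Restriction to a sub-cube.**  The monotone map `2^W → M_k` induced by `F` on the subsets of `W`, as an `MSunflower` on the subtype `↥W`:
its kernel / petals are the finite sets of `↥W` whose lift lies in the kernel / petal of `F`. [this work] -/
def restrict : MSunflower k {x // x ∈ W} where
  V i := univ.filter fun S => liftW W S ∈ F.V i
  A := univ.filter fun S => liftW W S ∈ F.A
  upperV := by
    intro i S T hST hS
    have hS' : liftW W S ∈ F.V i := (mem_filter.1 hS).2
    exact mem_filter.2 ⟨mem_univ _, F.upperV i ((liftW_subset_liftW W).2 hST) hS'⟩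
  upperA := by
    intro S T hST hS
    have hS' : liftW W S ∈ F.A := (mem_filter.1 hS).2
    exact mem_filter.2 ⟨mem_univ _, F.upperA ((liftW_subset_liftW W).2 hST) hS'⟩
  A_sub := by
    intro i S hS
    exact mem_filter.2 ⟨mem_univ _, F.A_sub i (mem_filter.1 hS).2⟩
  inter_sub := by
    intro i j hij S hS
    rw [mem_inter, mem_filter, mem_filter] at hS
    exact mem_filter.2 ⟨mem_univ _, F.inter_sub i j hij (mem_inter.2 ⟨hS.1.2, hS.2.2⟩)⟩

/-- Membership in the kernel of the restriction. [this work] -/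
theorem mem_restrict_A {S : Finset {x // x ∈ W}} : S ∈ (F.restrict W).A ↔ liftW W S ∈ F.A := by
  show S ∈ univ.filter (fun S => liftW W S ∈ F.A) ↔ _
  rw [mem_filter]; exact ⟨fun h => h.2, fun h => ⟨mem_univ _, h⟩⟩

/-- Membership in a petal up-set of the restriction. [this work] -/
theorem mem_restrict_V {i : Fin k} {S : Finset {x // x ∈ W}} : S ∈ (F.restrict W).V i ↔ liftW W S ∈ F.V i := by
  show S ∈ univ.filter (fun S => liftW W S ∈ F.V i) ↔ _
  rw [mem_filter]; exact ⟨fun h => h.2, fun h => ⟨mem_univ _, h⟩⟩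

/-- **The restriction has the same labels**: `(F.restrict W).lab S = F.lab (liftW W S)`. [this work] -/
theorem lab_restrict (S : Finset {x // x ∈ W}) : (F.restrict W).lab S = F.lab (liftW W S) := by
  rcases F.lab_cases (liftW W S) with hA | h0 | ⟨i, hA, hV, hl⟩
  · rw [((F.restrict W).lab_eq_last_iff S).2 ((F.mem_restrict_A W).2 hA), (F.lab_eq_last_iff _).2 hA]
  · rw [h0]
    have h0' := (F.lab_eq_zero_iff _).1 h0
    exact ((F.restrict W).lab_eq_zero_iff S).2
      ⟨fun h => h0'.1 ((F.mem_restrict_A W).1 h), fun i h => h0'.2 i ((F.mem_restrict_V W).1 h)⟩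
  · rw [hl]
    exact (F.restrict W).lab_eq_petalLab (fun h => hA ((F.mem_restrict_A W).1 h)) ((F.mem_restrict_V W).2 hV)

/-- **Transport of the top-cube slack**: the full-cube antipodal slack of the restriction is the slack `pslack W ∅` of the cube `2^W`. [this work] -/
theorem slackTop_restrict : (F.restrict W).slackTop = F.pslack W ∅ := by
  unfold slackTop
  rw [F.pslack_empty_offset, powerset_eq_map_liftEmb, sum_map]
  refine sum_congr rfl fun S _ => ?_
  rw [lab_restrict, lab_restrict, liftEmb_apply, liftW_compl]

/-- Transport of nested 3-partition sums: summing a function of the three lifted blocks over the ordered 3-partitions of the subtype is summing it over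
the ordered 3-partitions of `W`. [this work] -/
theorem nested_univ_liftW (g : Finset α → Finset α → Finset α → ℤ) :
    nested (univ : Finset {x // x ∈ W}) (fun X S T => g (liftW W X) (liftW W S) (liftW W T)) = nested W g := by
  unfold nested
  rw [powerset_univ, powerset_eq_map_liftEmb W, sum_map]
  refine sum_congr rfl fun X _ => ?_
  have hWX : W \ liftW W X = liftW W (univ \ X) := by rw [liftW_sdiff, liftW_univ]
  rw [liftEmb_apply, hWX, powerset_liftW, sum_map]
  refine sum_congr rfl fun S _ => ?_
  simp only [liftEmb_apply, liftW_sdiff, liftW_univ]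

/-- **Transport of the partition functional**: `ZK` of the restriction is the sub-cube functional `ZKW W`. [this work] -/
theorem ZK_restrict : (F.restrict W).ZK = F.ZKW W := by
  rw [← (F.restrict W).ZKW_univ]
  unfold ZKW
  have hfun : (fun X Y Z : Finset {x // x ∈ W} => s6K k ((F.restrict W).lab X) ((F.restrict W).lab Y) ((F.restrict W).lab Z))
      = fun X Y Z => s6K k (F.lab (liftW W X)) (F.lab (liftW W Y)) (F.lab (liftW W Z)) := by
    funext X Y Z
    rw [lab_restrict, lab_restrict, lab_restrict]
  rw [hfun]
  exact nested_univ_liftW W (fun X Y Z => s6K k (F.lab X) (F.lab Y) (F.lab Z))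

end MSunflower

/-- Example of transport: under ★ₖ every SUB-CUBE functional is nonnegative (apply ★ₖ to the restriction). [this work] -/
theorem MSunflower.ZKW_nonneg_of_partitionLemmaK {β : Type} [DecidableEq β] {k : ℕ} (F : MSunflower k β) (h : PartitionLemmaK)
    (W : Finset β) : 0 ≤ F.ZKW W := by
  rw [← F.ZK_restrict W]
  exact h k _ (F.restrict W)

end Summit.CriticalPhenomena.PercolationContinuityZ3.Theorems.SunflowerPartition
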